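import Literature.MathematicalPhysics.QuantumLattice.XYOrderIntegralProofs
import HarnessLib

/-!
# Kennedy–Lieb–Shastry: the numerical input in three dimensions — `limsup_L R_L(3) < 1/√6`

Trunk T-QLATTICE; sibling proof file of `HeisenbergOrder.lean` (named fact
`kennedy_lieb_shastry_ground`, item `provefact-Literature.MathematicalPhysics.QuantumLa-0a1fdca558`).
No statement of the tree is changed and no named fact is introduced. This file supplies the one
numerical input of the Kennedy–Lieb–Shastry proof of Néel order for `d = 3`, `S = ½`
(J. Stat. Phys. 53 (1988) 1019–1030, p. 1022: "we can evaluate the integral in (4) numerically and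
we find that the right side equals `0.0824 (e₀)^{1/2}`", i.e. `∫ d³q (E_q/E_{q-Q})^{1/2} ⅓(-Σcos qᵢ)₊
= 0.35`; the proof closes iff this is `< (2/9)√(27/8)·… = 1/√6 = 0.408`), in the finite-volume form
consumed by `kennedy_lieb_shastry_ground_of_riemannSum_three` (`HeisenbergOrderNeelGD.lean`):

`klsRiemannSum_three_eventually_le : ∃ ρ < 1/√6, ∀ᶠ L, klsRiemannSum 3 L ≤ ρ` (with `ρ = 2/5`).

## Method (a certified monotone upper Riemann sum)

The punctured Riemann sum is `R_L = L⁻³ Σ_{k ≠ 0} F(p_k)`, `F = klsIntegrand 3`,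
`F(p) = G(⅓Σᵢ cos pᵢ)`, `G(y) = √((1+y)/(1-y)) y₊` nondecreasing (`klsG_mono`, `XYOrderIntegralProofs`).
* Binning: with `m̃ᵢ ∈ (-L/2, L/2]` the signed representative of `kᵢ` and `bᵢ = ⌊2N|m̃ᵢ|/L⌋ ∈ {0,…,N}`
  (`N = 64`), `cos p_{k,i} ≤ cos(π bᵢ/N) ≤ K[bᵢ]/M - 1` (`M = 128`), where the table `K` of integers is
  CERTIFIED against the Taylor bounds `cos x ≤ 1 - x²/2 + x⁴/4! - x⁶/6! + x⁸/8!`,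
  `cos x ≥ 1 - x²/2 + x⁴/4! - x⁶/6!` (`x ≥ 0`, proved here by the monotonicity method of Mathlib's
  `Real.sin_gt_sub_cube`) and `3.141592 < π < 3.141593`, by a decidable check evaluated by the kernel
  (`checkK_tbl`);
* hence, off the *singular block* `{all K[bᵢ] = 2M}` (`= {all bᵢ < 3}`), `F(p_k) ≤ G(t/(3M) - 1)`,
  `t = Σᵢ K[bᵢ] < 6M`, and `G(t/(3M) - 1) ≤ g[t]/D` for a CERTIFIED integer table `g` (`D = 2¹⁶`;
  `checkG_tbl`: `D²s²(3M+s) ≤ g[t]² 9M²(3M-s)`, `s = t - 3M`);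
* counting: at most `L/N + 2` residues fall in each bin, so summing over `k` through the levels
  `K[bᵢ]` costs a factor `(L/N+2)³` times the triple sum `Σ_{b,b',b''} g[K_b + K_{b'} + K_{b''}]`, which
  the kernel evaluates as `Σ_t g[t] (c*c*c)[t] = 6558591247` with `c` the histogram of `K`
  (`wsum_convL`: weighted sums against a convolution of lists; `certTotal_tbl`);
* the singular block: there `F(p_k) ≤ √3 L/(2 maxᵢ|m̃ᵢ|)` (`klsIntegrand_le_of_ne_zero`) and the
  number of `k` with `maxᵢ |m̃ᵢ| = r` is at most `(2r+1)³ - (2r-1)³ = 24r² + 2`, `r ≤ 3L/128`, giving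
  `O(L³)·(√3/2)·12·(3/128)²`;
* so `R_L ≤ (1/64 + 2/L)³ · 6558591247/2¹⁶ + (√3/2)(108/16384 + 42/(128L) + 2/L²) ≤ 0.3886 < 2/5` for
  `L ≥ 2¹⁷`, and `2/5 < 1/√6`.
All numerical content is carried by three `decide` evaluations in the kernel (no `native_decide`).

## References

* [KLS1988JSP] T. Kennedy, E. H. Lieb, B. S. Shastry, J. Stat. Phys. 53 (1988) 1019–1030, p. 1022
  and eq. (4).
-/

noncomputable section

open Real Finset
open Literature.MathematicalPhysics.QuantumLattice Literature.Probability.LatticeModels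

namespace Literature.MathematicalPhysics.QuantumLattice

namespace KLSNumerics

/-! ### Taylor bounds for the cosine -/

/-- `cos x ≤ 1 - x²/2 + x⁴/24` for `0 ≤ x` (integrating `x - x³/6 < sin x`). [folklore] -/
theorem cos_le_taylor_four {x : ℝ} (hx : 0 ≤ x) : Real.cos x ≤ 1 - x ^ 2 / 2 + x ^ 4 / 24 := by
  let f (t : ℝ) : ℝ := 1 - t ^ 2 / 2 + t ^ 4 / 24 - Real.cos t
  have hderiv (t : ℝ) : deriv f t = -t + t ^ 3 / 6 + Real.sin t := by
    simp (disch := fun_prop) [f]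
    ring
  have hmono : MonotoneOn f (Set.Ici 0) := by
    apply monotoneOn_of_deriv_nonneg (convex_Ici 0) (by fun_prop) (by fun_prop)
    intro t ht
    rw [interior_Ici, Set.mem_Ioi] at ht
    rw [hderiv]
    have := Real.sin_gt_sub_cube ht
    linarith
  have h0 : f 0 ≤ f x := hmono (by simp) (Set.mem_Ici.2 hx) hx
  simp only [f, Real.cos_zero] at h0
  norm_num at h0
  linarith

/-- Auxiliary step of the certified Riemann-sum bound (Kennedy–Lieb–Shastry 1988, p. 1022, the numerical evaluation). [folklore] -/
theorem sin_le_taylor_five {x : ℝ} (hx : 0 ≤ x) : Real.sin x ≤ x - x ^ 3 / 6 + x ^ 5 / 120 := by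
  let f (t : ℝ) : ℝ := t - t ^ 3 / 6 + t ^ 5 / 120 - Real.sin t
  have hderiv (t : ℝ) : deriv f t = 1 - t ^ 2 / 2 + t ^ 4 / 24 - Real.cos t := by
    simp (disch := fun_prop) [f]
    ring
  have hmono : MonotoneOn f (Set.Ici 0) := by
    apply monotoneOn_of_deriv_nonneg (convex_Ici 0) (by fun_prop) (by fun_prop)
    intro t ht
    rw [interior_Ici, Set.mem_Ioi] at ht
    rw [hderiv]
    have := cos_le_taylor_four ht.le
    linarith
  have h0 : f 0 ≤ f x := hmono (by simp) (Set.mem_Ici.2 hx) hx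
  simp only [f, Real.sin_zero] at h0
  norm_num at h0
  linarith

/-- Auxiliary step of the certified Riemann-sum bound (Kennedy–Lieb–Shastry 1988, p. 1022, the numerical evaluation). [folklore] -/
theorem taylor_six_le_cos {x : ℝ} (hx : 0 ≤ x) :
    1 - x ^ 2 / 2 + x ^ 4 / 24 - x ^ 6 / 720 ≤ Real.cos x := by
  let f (t : ℝ) : ℝ := Real.cos t - (1 - t ^ 2 / 2 + t ^ 4 / 24 - t ^ 6 / 720)
  have hderiv (t : ℝ) : deriv f t = -Real.sin t + t - t ^ 3 / 6 + t ^ 5 / 120 := by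
    simp (disch := fun_prop) [f]
    ring
  have hmono : MonotoneOn f (Set.Ici 0) := by
    apply monotoneOn_of_deriv_nonneg (convex_Ici 0) (by fun_prop) (by fun_prop)
    intro t ht
    rw [interior_Ici, Set.mem_Ioi] at ht
    rw [hderiv]
    have := sin_le_taylor_five ht.le
    linarith
  have h0 : f 0 ≤ f x := hmono (by simp) (Set.mem_Ici.2 hx) hx
  simp only [f, Real.cos_zero] at h0
  norm_num at h0
  linarith

/-- Auxiliary step of the certified Riemann-sum bound (Kennedy–Lieb–Shastry 1988, p. 1022, the numerical evaluation). [folklore] -/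
theorem taylor_seven_le_sin {x : ℝ} (hx : 0 ≤ x) :
    x - x ^ 3 / 6 + x ^ 5 / 120 - x ^ 7 / 5040 ≤ Real.sin x := by
  let f (t : ℝ) : ℝ := Real.sin t - (t - t ^ 3 / 6 + t ^ 5 / 120 - t ^ 7 / 5040)
  have hderiv (t : ℝ) : deriv f t = Real.cos t - (1 - t ^ 2 / 2 + t ^ 4 / 24 - t ^ 6 / 720) := by
    simp (disch := fun_prop) [f]
    ring
  have hmono : MonotoneOn f (Set.Ici 0) := by
    apply monotoneOn_of_deriv_nonneg (convex_Ici 0) (by fun_prop) (by fun_prop)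
    intro t ht
    rw [interior_Ici, Set.mem_Ioi] at ht
    rw [hderiv]
    have := taylor_six_le_cos ht.le
    linarith
  have h0 : f 0 ≤ f x := hmono (by simp) (Set.mem_Ici.2 hx) hx
  simp only [f, Real.sin_zero] at h0
  norm_num at h0
  linarith

/-- Auxiliary step of the certified Riemann-sum bound (Kennedy–Lieb–Shastry 1988, p. 1022, the numerical evaluation). [folklore] -/
theorem cos_le_taylor_eight {x : ℝ} (hx : 0 ≤ x) :
    Real.cos x ≤ 1 - x ^ 2 / 2 + x ^ 4 / 24 - x ^ 6 / 720 + x ^ 8 / 40320 := by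
  let f (t : ℝ) : ℝ := 1 - t ^ 2 / 2 + t ^ 4 / 24 - t ^ 6 / 720 + t ^ 8 / 40320 - Real.cos t
  have hderiv (t : ℝ) : deriv f t = -t + t ^ 3 / 6 - t ^ 5 / 120 + t ^ 7 / 5040 + Real.sin t := by
    simp (disch := fun_prop) [f]
    ring
  have hmono : MonotoneOn f (Set.Ici 0) := by
    apply monotoneOn_of_deriv_nonneg (convex_Ici 0) (by fun_prop) (by fun_prop)
    intro t ht
    rw [interior_Ici, Set.mem_Ioi] at ht
    rw [hderiv]
    have := taylor_seven_le_sin ht.le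
    linarith
  have h0 : f 0 ≤ f x := hmono (by simp) (Set.mem_Ici.2 hx) hx
  simp only [f, Real.cos_zero] at h0
  norm_num at h0
  linarith

/-! ### Lists: pointwise sum, convolution, weighted sums -/

/-- Pointwise sum of two lists of naturals (the shorter one padded with zeros). [folklore] -/
def addL : List ℕ → List ℕ → List ℕ
  | [], l => l
  | a :: as, [] => a :: as
  | a :: as, b :: bs => (a + b) :: addL as bs

/-- Convolution of two lists of naturals: `(convL a b)[t] = Σ_{i+j=t} a[i] b[j]`. [folklore] -/
def convL : List ℕ → List ℕ → List ℕ
  | [], _ => []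
  | a :: as, bs => addL (bs.map (a * ·)) (0 :: convL as bs)

/-- Dot product of two lists of naturals (truncated to the shorter). [folklore] -/
def dotL : List ℕ → List ℕ → ℕ
  | a :: as, b :: bs => a * b + dotL as bs
  | _, _ => 0

/-- Histogram of a list of naturals on `{0, …, len-1}`. [folklore] -/
def histL (K : List ℕ) (len : ℕ) : List ℕ := (List.range len).map fun t => K.count t

/-- Weighted sum `Σ_i φ(i) l[i]` of a list of natural weights against a real sequence. [folklore] -/
def wsum (φ : ℕ → ℝ) : List ℕ → ℝ
  | [] => 0
  | a :: l => φ 0 * a + wsum (fun i => φ (i + 1)) l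

/-- Auxiliary step of the certified Riemann-sum bound (Kennedy–Lieb–Shastry 1988, p. 1022, the numerical evaluation). [folklore] -/
@[simp] theorem wsum_nil (φ : ℕ → ℝ) : wsum φ [] = 0 := rfl

/-- Auxiliary step of the certified Riemann-sum bound (Kennedy–Lieb–Shastry 1988, p. 1022, the numerical evaluation). [folklore] -/
theorem wsum_cons (φ : ℕ → ℝ) (a : ℕ) (l : List ℕ) :
    wsum φ (a :: l) = φ 0 * a + wsum (fun i => φ (i + 1)) l := rfl

/-- Auxiliary step of the certified Riemann-sum bound (Kennedy–Lieb–Shastry 1988, p. 1022, the numerical evaluation). [folklore] -/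
theorem wsum_addL (φ : ℕ → ℝ) (u v : List ℕ) : wsum φ (addL u v) = wsum φ u + wsum φ v := by
  induction u generalizing φ v with
  | nil => simp [addL]
  | cons a as ih =>
    cases v with
    | nil => simp [addL]
    | cons b bs =>
      simp only [addL, wsum_cons, ih, Nat.cast_add]
      ring

/-- Auxiliary step of the certified Riemann-sum bound (Kennedy–Lieb–Shastry 1988, p. 1022, the numerical evaluation). [folklore] -/
theorem wsum_map_mul (φ : ℕ → ℝ) (x : ℕ) (u : List ℕ) :
    wsum φ (u.map (x * ·)) = x * wsum φ u := by
  induction u generalizing φ with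
  | nil => simp
  | cons a as ih =>
    simp only [List.map_cons, wsum_cons, ih, Nat.cast_mul]
    ring

/-- Auxiliary step of the certified Riemann-sum bound (Kennedy–Lieb–Shastry 1988, p. 1022, the numerical evaluation). [folklore] -/
theorem wsum_convL (φ : ℕ → ℝ) (a b : List ℕ) :
    wsum φ (convL a b) = wsum (fun i => wsum (fun j => φ (i + j)) b) a := by
  induction a generalizing φ with
  | nil => simp [convL]
  | cons x as ih =>
    rw [convL, wsum_addL, wsum_map_mul, wsum_cons, wsum_cons, Nat.cast_zero, mul_zero, zero_add, ih]
    simp only [Nat.zero_add]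
    congr 1
    · ring
    · congr 1
      funext i
      congr 1
      funext j
      rw [Nat.add_right_comm]

/-- Auxiliary step of the certified Riemann-sum bound (Kennedy–Lieb–Shastry 1988, p. 1022, the numerical evaluation). [folklore] -/
theorem wsum_congr {φ ψ : ℕ → ℝ} (l : List ℕ) (h : ∀ i, φ i = ψ i) : wsum φ l = wsum ψ l := by
  rw [show φ = ψ from funext h]

/-- Auxiliary step of the certified Riemann-sum bound (Kennedy–Lieb–Shastry 1988, p. 1022, the numerical evaluation). [folklore] -/
theorem wsum_mono {φ ψ : ℕ → ℝ} (l : List ℕ) (h : ∀ i, φ i ≤ ψ i) : wsum φ l ≤ wsum ψ l := by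
  induction l generalizing φ ψ with
  | nil => simp
  | cons a as ih =>
    simp only [wsum_cons]
    exact add_le_add (mul_le_mul_of_nonneg_right (h 0) (Nat.cast_nonneg _))
      (ih fun i => h (i + 1))

/-- Auxiliary step of the certified Riemann-sum bound (Kennedy–Lieb–Shastry 1988, p. 1022, the numerical evaluation). [folklore] -/
theorem wsum_nonneg {φ : ℕ → ℝ} (l : List ℕ) (h : ∀ i, 0 ≤ φ i) : 0 ≤ wsum φ l := by
  induction l generalizing φ with
  | nil => simp
  | cons a as ih =>
    simp only [wsum_cons]
    exact add_nonneg (mul_nonneg (h 0) (Nat.cast_nonneg _)) (ih fun i => h (i + 1))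

/-- Auxiliary step of the certified Riemann-sum bound (Kennedy–Lieb–Shastry 1988, p. 1022, the numerical evaluation). [folklore] -/
theorem wsum_smul (c : ℝ) (φ : ℕ → ℝ) (l : List ℕ) : wsum (fun i => c * φ i) l = c * wsum φ l := by
  induction l generalizing φ with
  | nil => simp
  | cons a as ih =>
    simp only [wsum_cons]
    rw [ih (fun i => φ (i + 1))]
    ring

/-- Auxiliary step of the certified Riemann-sum bound (Kennedy–Lieb–Shastry 1988, p. 1022, the numerical evaluation). [folklore] -/
theorem wsum_const_zero (l : List ℕ) : wsum (fun _ => (0 : ℝ)) l = 0 := by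
  induction l with
  | nil => rfl
  | cons a as ih => rw [wsum_cons, zero_mul, zero_add]; exact ih

/-- The dot product with a table is the weighted sum against the table read as a sequence. [folklore] -/
theorem dotL_eq_wsum (g l : List ℕ) : (dotL g l : ℝ) = wsum (fun t => (g.getD t 0 : ℝ)) l := by
  induction l generalizing g with
  | nil => cases g <;> simp [dotL]
  | cons b bs ih =>
    cases g with
    | nil =>
      simp only [dotL, Nat.cast_zero, wsum_cons, List.getD_nil, zero_mul, zero_add]
      exact (wsum_const_zero bs).symm
    | cons a as =>
      simp only [dotL, Nat.cast_add, Nat.cast_mul, wsum_cons, List.getD_cons_zero, List.getD_cons_succ]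
      rw [ih as]

/-- A weighted sum as a `Finset.sum` over the indices. [folklore] -/
theorem wsum_eq_sum_range (φ : ℕ → ℝ) (l : List ℕ) :
    wsum φ l = ∑ t ∈ range l.length, φ t * (l.getD t 0 : ℝ) := by
  induction l generalizing φ with
  | nil => simp
  | cons a as ih =>
    rw [wsum_cons, List.length_cons, Finset.sum_range_succ', ih]
    simp only [List.getD_cons_succ, List.getD_cons_zero]
    ring

/-- Fibrewise bound: if the level `s a` of every element is `< c.length` and the number of elements
at level `t` is at most `W c[t]`, then `Σ_a φ(s a) ≤ W · wsum φ c` for nonnegative `φ`. [folklore] -/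
theorem sum_level_le_wsum {α : Type*} [Fintype α] [DecidableEq α] (s : α → ℕ) (c : List ℕ) {W : ℝ}
    (hs : ∀ a, s a < c.length)
    (hcard : ∀ t, ((univ.filter fun a => s a = t).card : ℝ) ≤ W * (c.getD t 0 : ℝ))
    {φ : ℕ → ℝ} (hφ : ∀ t, 0 ≤ φ t) :
    ∑ a, φ (s a) ≤ W * wsum φ c := by
  rw [wsum_eq_sum_range, mul_sum]
  have hmaps : ∀ a ∈ (univ : Finset α), s a ∈ range c.length := fun a _ => mem_range.2 (hs a)
  rw [← sum_fiberwise_of_maps_to hmaps]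
  refine sum_le_sum fun t _ => ?_
  rw [sum_congr rfl fun a ha => by rw [(mem_filter.1 ha).2], sum_const, nsmul_eq_mul]
  calc ((univ.filter fun a => s a = t).card : ℝ) * φ t ≤ W * (c.getD t 0 : ℝ) * φ t :=
        mul_le_mul_of_nonneg_right (hcard t) (hφ t)
    _ = W * (φ t * (c.getD t 0 : ℝ)) := by ring

/-! ### The cosine table and its certificate -/

/-- The rational Taylor polynomial `T₈(x) = 1 - x²/2 + x⁴/4! - x⁶/6! + x⁸/8!`. [folklore] -/
def T8q (x : ℚ) : ℚ := 1 - x ^ 2 / 2 + x ^ 4 / 24 - x ^ 6 / 720 + x ^ 8 / 40320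

/-- The rational Taylor polynomial `T₆(x) = 1 - x²/2 + x⁴/4! - x⁶/6!`. [folklore] -/
def T6q (x : ℚ) : ℚ := 1 - x ^ 2 / 2 + x ^ 4 / 24 - x ^ 6 / 720

/-- Auxiliary step of the certified Riemann-sum bound (Kennedy–Lieb–Shastry 1988, p. 1022, the numerical evaluation). [folklore] -/
def checkK (N M : ℕ) (K : List ℕ) : Bool :=
  (List.range (N + 1)).all fun b =>
    if 2 * b ≤ N then
      decide ((M : ℚ) * T8q (3141592 * (b : ℚ) / (1000000 * (N : ℚ))) + M ≤ (K.getD b 0 : ℚ))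
    else
      decide ((M : ℚ) - M * T6q (3141593 * ((N : ℚ) - b) / (1000000 * (N : ℚ))) ≤ (K.getD b 0 : ℚ))

/-- Auxiliary step of the certified Riemann-sum bound (Kennedy–Lieb–Shastry 1988, p. 1022, the numerical evaluation). [folklore] -/
theorem pi_lb : (3141592 : ℝ) ≤ 1000000 * Real.pi := by
  have := Real.pi_gt_d6; norm_num at this ⊢; linarith

/-- Auxiliary step of the certified Riemann-sum bound (Kennedy–Lieb–Shastry 1988, p. 1022, the numerical evaluation). [folklore] -/
theorem pi_ub : 1000000 * Real.pi ≤ (3141593 : ℝ) := by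
  have := Real.pi_lt_d6; norm_num at this ⊢; linarith

/-- The real content of the cosine table: `cos(πb/N) ≤ K[b]/M - 1` for `b ≤ N`. [folklore] -/
theorem cos_table_le {N M : ℕ} (hN : 0 < N) (hM : 0 < M) {K : List ℕ} (hK : checkK N M K = true)
    {b : ℕ} (hb : b ≤ N) :
    Real.cos (Real.pi * b / N) ≤ (K.getD b 0 : ℝ) / M - 1 := by
  have hN' : (0 : ℝ) < N := by exact_mod_cast hN
  have hM' : (0 : ℝ) < M := by exact_mod_cast hM
  have h := List.all_eq_true.1 hK b (List.mem_range.2 (by omega))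
  split_ifs at h with h2
  · -- first half: upper Taylor bound
    have hq := of_decide_eq_true h
    have hr : (M : ℝ) * (1 - (3141592 * (b : ℝ) / (1000000 * N)) ^ 2 / 2 +
        (3141592 * (b : ℝ) / (1000000 * N)) ^ 4 / 24 - (3141592 * (b : ℝ) / (1000000 * N)) ^ 6 / 720 +
        (3141592 * (b : ℝ) / (1000000 * N)) ^ 8 / 40320) + M ≤ (K.getD b 0 : ℝ) := by
      have := (Rat.cast_le (K := ℝ)).2 hq
      push_cast [T8q] at this
      exact this
    set x : ℝ := 3141592 * (b : ℝ) / (1000000 * N) with hx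
    have hx0 : 0 ≤ x := by positivity
    have hxle : x ≤ Real.pi * b / N := by
      rw [hx, div_le_div_iff₀ (by positivity) hN']
      have hb0 : (0 : ℝ) ≤ b := Nat.cast_nonneg _
      nlinarith [mul_nonneg (mul_nonneg hb0 hN'.le) (sub_nonneg.2 pi_lb)]
    have hyπ : Real.pi * b / N ≤ Real.pi := by
      rw [div_le_iff₀ hN']
      have : (b : ℝ) ≤ N := by exact_mod_cast hb
      nlinarith [Real.pi_pos]
    have h1 : Real.cos (Real.pi * b / N) ≤ Real.cos x := Real.cos_le_cos_of_nonneg_of_le_pi hx0 hyπ hxle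
    have h2 := cos_le_taylor_eight hx0
    rw [le_sub_iff_add_le, le_div_iff₀ hM']
    nlinarith [h1, h2, hr, hM']
  · -- second half: lower Taylor bound at the reflected angle
    have hq := of_decide_eq_true h
    rw [not_le] at h2
    have hbN : (b : ℝ) ≤ N := by exact_mod_cast hb
    have hr : (M : ℝ) - M * (1 - (3141593 * ((N : ℝ) - b) / (1000000 * N)) ^ 2 / 2 +
        (3141593 * ((N : ℝ) - b) / (1000000 * N)) ^ 4 / 24 -
        (3141593 * ((N : ℝ) - b) / (1000000 * N)) ^ 6 / 720) ≤ (K.getD b 0 : ℝ) := by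
      have := (Rat.cast_le (K := ℝ)).2 hq
      push_cast [T6q] at this
      exact this
    set y : ℝ := 3141593 * ((N : ℝ) - b) / (1000000 * N) with hy
    have hNb : 0 ≤ (N : ℝ) - b := by linarith
    have hy0 : 0 ≤ y := by positivity
    have hyle : Real.pi * ((N : ℝ) - b) / N ≤ y := by
      rw [hy, div_le_div_iff₀ hN' (by positivity)]
      nlinarith [mul_nonneg (mul_nonneg hNb hN'.le) (sub_nonneg.2 pi_ub)]
    have hyπ : y ≤ Real.pi := by
      rw [hy, div_le_iff₀ (by positivity)]
      have h2' : 2 * ((N : ℝ) - b) ≤ N := by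
        have : (N : ℝ) < 2 * b := by exact_mod_cast h2
        linarith
      nlinarith [pi_lb, h2']
    have hz0 : 0 ≤ Real.pi * ((N : ℝ) - b) / N := by positivity
    have h1 : Real.cos y ≤ Real.cos (Real.pi * ((N : ℝ) - b) / N) :=
      Real.cos_le_cos_of_nonneg_of_le_pi hz0 hyπ hyle
    have h3 := taylor_six_le_cos hy0
    have hrefl : Real.cos (Real.pi * b / N) = -Real.cos (Real.pi * ((N : ℝ) - b) / N) := by
      rw [← Real.cos_pi_sub]
      congr 1
      field_simp
      ring
    rw [hrefl, le_sub_iff_add_le, le_div_iff₀ hM']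
    nlinarith [h1, h3, hr, hM']

/-! ### Binning of the dual torus -/


/-- `|m̃|` for the signed representative `m̃ ∈ (-L/2, L/2]` of a residue. [folklore] -/
def absm {L : ℕ} (a : ZMod L) : ℕ := a.valMinAbs.natAbs

/-- The coarse bin `⌊2N|m̃|/L⌋ ∈ {0, …, N}` of a residue. [folklore] -/
def binOf (N L : ℕ) (a : ZMod L) : ℕ := 2 * N * absm a / L

/-- Auxiliary step of the certified Riemann-sum bound (Kennedy–Lieb–Shastry 1988, p. 1022, the numerical evaluation). [folklore] -/
theorem two_mul_absm_le (L : ℕ) [NeZero L] (a : ZMod L) : 2 * absm a ≤ L := by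
  have h := ZMod.natAbs_valMinAbs_le a
  unfold absm
  omega

/-- Auxiliary step of the certified Riemann-sum bound (Kennedy–Lieb–Shastry 1988, p. 1022, the numerical evaluation). [folklore] -/
theorem binOf_le (N L : ℕ) [NeZero L] (a : ZMod L) : binOf N L a ≤ N := by
  unfold binOf
  have h := two_mul_absm_le L a
  have hL : 0 < L := Nat.pos_of_ne_zero (NeZero.ne L)
  calc 2 * N * absm a / L ≤ N * L / L := Nat.div_le_div_right (by nlinarith)
    _ = N := Nat.mul_div_cancel _ hL

/-- Auxiliary step of the certified Riemann-sum bound (Kennedy–Lieb–Shastry 1988, p. 1022, the numerical evaluation). [folklore] -/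
theorem absm_eq_zero_iff {L : ℕ} [NeZero L] (a : ZMod L) : absm a = 0 ↔ a = 0 := by
  rw [absm, Int.natAbs_eq_zero, ZMod.valMinAbs_eq_zero]

/-- `cos p_{k,i} = cos(2π |m̃ᵢ| / L)`. [folklore] -/
theorem cos_latticeMomentum_eq_cos_absm (L : ℕ) [NeZero L] {ν : ℕ} (k : TorusSite ν L) (i : Fin ν) :
    Real.cos (latticeMomentum L k i) = Real.cos (2 * Real.pi * (absm (k i) : ℝ) / L) := by
  rw [cos_latticeMomentum_eq_cos_valMinAbs, absm, Nat.cast_natAbs, Int.cast_abs, ← Real.cos_abs]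
  congr 1
  have hL : (0 : ℝ) < L := by exact_mod_cast Nat.pos_of_ne_zero (NeZero.ne L)
  rw [abs_mul, abs_of_pos (by positivity : (0 : ℝ) < 2 * Real.pi / L)]
  ring

/-- **Binning**: `cos p_{k,i} ≤ cos(π bᵢ / N)` with `bᵢ = ⌊2N|m̃ᵢ|/L⌋`. [folklore] -/
theorem cos_latticeMomentum_le_cos_bin (N L : ℕ) [NeZero L] (hN : 0 < N) {ν : ℕ} (k : TorusSite ν L)
    (i : Fin ν) :
    Real.cos (latticeMomentum L k i) ≤ Real.cos (Real.pi * (binOf N L (k i)) / N) := by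
  have hL : (0 : ℝ) < L := by exact_mod_cast Nat.pos_of_ne_zero (NeZero.ne L)
  have hN' : (0 : ℝ) < N := by exact_mod_cast hN
  rw [cos_latticeMomentum_eq_cos_absm]
  refine Real.cos_le_cos_of_nonneg_of_le_pi (by positivity) ?_ ?_
  · -- `2π|m̃|/L ≤ π`
    have h := two_mul_absm_le L (k i)
    have h' : (2 * absm (k i) : ℝ) ≤ L := by exact_mod_cast h
    rw [div_le_iff₀ hL]
    nlinarith [Real.pi_pos]
  · -- `π b/N ≤ 2π|m̃|/L` since `b L ≤ 2N|m̃|`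
    have h := Nat.div_mul_le_self (2 * N * absm (k i)) L
    have h' : ((binOf N L (k i)) : ℝ) * L ≤ 2 * N * absm (k i) := by
      unfold binOf
      exact_mod_cast h
    rw [div_le_div_iff₀ hN' hL]
    nlinarith [Real.pi_pos, h']

/-! ### The function `G` and the per-point bound -/


/-- `G(y) = √((1+y)/(1-y)) · y₊`. [folklore] -/
noncomputable def klsG (y : ℝ) : ℝ := Real.sqrt ((1 + y) / (1 - y)) * max y 0

/-- Auxiliary step of the certified Riemann-sum bound (Kennedy–Lieb–Shastry 1988, p. 1022, the numerical evaluation). [folklore] -/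
theorem klsG_nonneg (y : ℝ) : 0 ≤ klsG y := by unfold klsG; positivity

/-- **Per-point bound outside the singular block**: with the levels `sᵢ = K[bᵢ]`,
`F₃(p_k) ≤ G((s₀+s₁+s₂)/(3M) - 1)` whenever `s₀+s₁+s₂ < 6M`. [folklore] -/
theorem klsIntegrand_le_klsG_levels (L : ℕ) [NeZero L] {N M : ℕ} (hN : 0 < N) (hM : 0 < M)
    {K : List ℕ} (hK : checkK N M K = true) (k : TorusSite 3 L)
    (hreg : (∑ i, K.getD (binOf N L (k i)) 0) < 6 * M) :
    klsIntegrand 3 (latticeMomentum L k) ≤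
      klsG (((∑ i, K.getD (binOf N L (k i)) 0 : ℕ) : ℝ) / (3 * M) - 1) := by
  have hM' : (0 : ℝ) < M := by exact_mod_cast hM
  rw [klsIntegrand_eq_G (by norm_num), klsG]
  refine klsG_mono ?_ ?_
  · -- `(Σ cos)/3 ≤ (Σ s)/(3M) - 1`
    have hc : ∀ i, Real.cos (latticeMomentum L k i) ≤ (K.getD (binOf N L (k i)) 0 : ℝ) / M - 1 :=
      fun i => (cos_latticeMomentum_le_cos_bin N L hN k i).trans
        (cos_table_le hN hM hK (binOf_le N L (k i)))
    have hs := Finset.sum_le_sum fun i (_ : i ∈ Finset.univ) => hc i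
    rw [Nat.cast_sum]
    have h3 : ((3 : ℕ) : ℝ) = 3 := by norm_num
    rw [h3]
    calc (∑ i, Real.cos (latticeMomentum L k i)) / 3 ≤ (∑ i, ((K.getD (binOf N L (k i)) 0 : ℝ) / M - 1)) / 3 :=
          div_le_div_of_nonneg_right hs (by norm_num)
      _ = (∑ i, (K.getD (binOf N L (k i)) 0 : ℝ)) / (3 * M) - 1 := by
          rw [sum_sub_distrib, ← sum_div]
          simp only [sum_const, card_univ, Fintype.card_fin, nsmul_eq_mul, Nat.cast_ofNat, mul_one]
          field_simp
  · have : ((∑ i, K.getD (binOf N L (k i)) 0 : ℕ) : ℝ) < 6 * M := by exact_mod_cast hreg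
    rw [Nat.cast_sum] at this ⊢
    rw [sub_lt_iff_lt_add, div_lt_iff₀ (by positivity)]
    linarith

/-! ### The `G` table and its certificate -/

/-- The certificate for the `G` table: `D² s² (3M+s) ≤ g[t]² 9M² (3M-s)`, `s = t - 3M`, for
`3M < t < 6M`. [folklore] -/
def checkG (M D : ℕ) (g : List ℕ) : Bool :=
  (List.range (6 * M)).all fun t => decide (t ≤ 3 * M) ||
    decide (D * D * (t - 3 * M) * (t - 3 * M) * (3 * M + (t - 3 * M)) ≤
      (g.getD t 0) * (g.getD t 0) * 9 * M * M * (3 * M - (t - 3 * M)))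

/-- The real content of the `G` table: `G(t/(3M) - 1) ≤ g[t]/D` for `t < 6M`. [folklore] -/
theorem klsG_le_table {M D : ℕ} (hM : 0 < M) (hD : 0 < D) {g : List ℕ} (hg : checkG M D g = true)
    {t : ℕ} (ht : t < 6 * M) :
    klsG ((t : ℝ) / (3 * M) - 1) ≤ (g.getD t 0 : ℝ) / D := by
  have hM' : (0 : ℝ) < M := by exact_mod_cast hM
  have hD' : (0 : ℝ) < D := by exact_mod_cast hD
  have h := List.all_eq_true.1 hg t (List.mem_range.2 ht)
  rw [Bool.or_eq_true] at h
  rcases le_or_gt t (3 * M) with hle | hgt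
  · -- `y ≤ 0`: `G = 0`
    have hy : (t : ℝ) / (3 * M) - 1 ≤ 0 := by
      rw [sub_nonpos, div_le_one (by positivity)]
      exact_mod_cast hle
    rw [klsG, max_eq_right hy, mul_zero]
    positivity
  · obtain ⟨S, rfl⟩ : ∃ S, t = 3 * M + S := ⟨t - 3 * M, by omega⟩
    have hS3 : S < 3 * M := by omega
    rcases h with h | h
    · exact absurd (of_decide_eq_true h) (by omega)
    have hq := of_decide_eq_true h
    simp only [Nat.add_sub_cancel_left] at hq
    -- real form of the certificate
    have hq' : (D : ℝ) * D * S * S * (3 * M + S) ≤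
        (g.getD (3 * M + S) 0 : ℝ) * (g.getD (3 * M + S) 0) * 9 * M * M * ((3 * M - S : ℕ) : ℝ) := by
      exact_mod_cast hq
    rw [Nat.cast_sub hS3.le] at hq'
    push_cast at hq'
    have hSr : (0 : ℝ) < 3 * M - S := by
      have : (S : ℝ) < 3 * M := by exact_mod_cast hS3
      linarith
    -- the value of `G`
    have hy : ((3 * M + S : ℕ) : ℝ) / (3 * M) - 1 = (S : ℝ) / (3 * M) := by
      push_cast; field_simp; ring
    have hypos : 0 ≤ (S : ℝ) / (3 * M) := by positivity
    rw [hy, klsG, max_eq_left hypos]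
    have hfrac : (1 + (S : ℝ) / (3 * M)) / (1 - (S : ℝ) / (3 * M)) = (3 * M + S) / (3 * M - S) := by
      field_simp
    rw [hfrac]
    -- compare squares
    set u : ℝ := (g.getD (3 * M + S) 0 : ℝ) with hu_def
    have hu : 0 ≤ u / D := by positivity
    have hlhs0 : 0 ≤ Real.sqrt ((3 * M + S) / (3 * M - S)) * ((S : ℝ) / (3 * M)) := by positivity
    rw [← pow_le_pow_iff_left₀ hlhs0 hu two_ne_zero, mul_pow, Real.sq_sqrt (by positivity), div_pow,
      div_pow, div_mul_div_comm, div_le_div_iff₀ (by positivity) (by positivity)]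
    have e1 : (3 * (M : ℝ) + S) * (S : ℝ) ^ 2 * (D : ℝ) ^ 2 = (D : ℝ) * D * S * S * (3 * M + S) := by ring
    have e2 : u ^ 2 * ((3 * (M : ℝ) - S) * (3 * (M : ℝ)) ^ 2) = u * u * 9 * M * M * (3 * M - S) := by ring
    rw [e1, e2]
    exact hq'

/-! ### Counting residues per bin -/

/-- The fibres of `a ↦ |m̃|` have at most two elements. [folklore] -/
theorem card_filter_absm_eq_le_two {L : ℕ} [NeZero L] (s : Finset (ZMod L)) (n : ℕ) :
    (s.filter fun a => absm a = n).card ≤ 2 := by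
  refine (Finset.card_le_card (show s.filter (fun a => absm a = n) ⊆
    {((n : ℤ) : ZMod L), (((-n : ℤ)) : ZMod L)} from ?_)).trans Finset.card_le_two
  intro a ha
  rw [mem_filter] at ha
  have h := Int.natAbs_eq a.valMinAbs
  rw [show a.valMinAbs.natAbs = n from ha.2] at h
  rw [Finset.mem_insert, Finset.mem_singleton]
  rcases h with h | h
  · left; rw [← ZMod.coe_valMinAbs a, h]
  · right; rw [← ZMod.coe_valMinAbs a, h]


/-- **At most `L/N + 2` residues per bin.** [folklore] -/
theorem card_filter_binOf_le (N L : ℕ) [NeZero L] (hN : 0 < N) (b : ℕ) :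
    (((univ : Finset (ZMod L)).filter fun a => binOf N L a = b).card : ℝ) ≤ (L : ℝ) / N + 2 := by
  have hL : 0 < L := Nat.pos_of_ne_zero (NeZero.ne L)
  have hN' : (0 : ℝ) < N := by exact_mod_cast hN
  set S := (univ : Finset (ZMod L)).filter fun a => binOf N L a = b with hS
  set T := S.image absm with hT
  -- (i) `|S| ≤ 2 |T|`
  have h1 : S.card ≤ 2 * T.card :=
    card_le_mul_card_image S 2 fun n _ => card_filter_absm_eq_le_two S n
  -- (ii) the elements of `T` satisfy `b L ≤ 2N n < (b+1) L`
  have hT1 : ∀ n ∈ T, b * L ≤ 2 * N * n ∧ 2 * N * n < b * L + L := by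
    intro n hn
    obtain ⟨a, ha, rfl⟩ := mem_image.1 hn
    have hb : 2 * N * absm a / L = b := (mem_filter.1 ha).2
    constructor
    · have := Nat.div_mul_le_self (2 * N * absm a) L
      rw [hb] at this
      exact this
    · have := Nat.lt_div_mul_add (a := 2 * N * absm a) hL
      rw [hb] at this
      exact this
  -- (iii) `|T| ≤ L/(2N) + 1`
  have h2 : (T.card : ℝ) ≤ (L : ℝ) / (2 * N) + 1 := by
    rcases T.eq_empty_or_nonempty with hT0 | hTne
    · rw [hT0, card_empty, Nat.cast_zero]
      try positivity
    · set n₀ := T.min' hTne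
      set n₁ := T.max' hTne
      have hsub : T ⊆ Icc n₀ n₁ := fun n hn => mem_Icc.2 ⟨T.min'_le n hn, T.le_max' n hn⟩
      have hc : T.card ≤ n₁ + 1 - n₀ := (card_le_card hsub).trans (by rw [Nat.card_Icc])
      have h01 : n₀ ≤ n₁ := T.min'_le _ (T.max'_mem hTne)
      obtain ⟨hlo, -⟩ := hT1 n₀ (T.min'_mem hTne)
      obtain ⟨-, hhi⟩ := hT1 n₁ (T.max'_mem hTne)
      have hdiff : 2 * N * (n₁ - n₀) < L := by
        have : 2 * N * n₁ < 2 * N * n₀ + L := by omega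
        rw [Nat.mul_sub]
        omega
      have hdiff' : ((n₁ - n₀ : ℕ) : ℝ) < (L : ℝ) / (2 * N) := by
        rw [lt_div_iff₀ (by positivity)]
        have : ((2 * N * (n₁ - n₀) : ℕ) : ℝ) < L := by exact_mod_cast hdiff
        push_cast at this
        linarith
      have hc' : (T.card : ℝ) ≤ ((n₁ - n₀ : ℕ) : ℝ) + 1 := by
        have : T.card ≤ (n₁ - n₀) + 1 := by omega
        exact_mod_cast this
      linarith
  calc (S.card : ℝ) ≤ 2 * (T.card : ℝ) := by exact_mod_cast h1
    _ ≤ 2 * ((L : ℝ) / (2 * N) + 1) := by linarith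
    _ = (L : ℝ) / N + 2 := by field_simp


/-! ### Histogram of the level table -/

/-- Auxiliary step of the certified Riemann-sum bound (Kennedy–Lieb–Shastry 1988, p. 1022, the numerical evaluation). [folklore] -/
theorem histL_getD (K : List ℕ) {len t : ℕ} (ht : t < len) : (histL K len).getD t 0 = K.count t := by
  simp [histL, List.getD_eq_getElem?_getD, ht]

/-- Auxiliary step of the certified Riemann-sum bound (Kennedy–Lieb–Shastry 1988, p. 1022, the numerical evaluation). [folklore] -/
theorem histL_length (K : List ℕ) (len : ℕ) : (histL K len).length = len := by simp [histL]

/-- The number of indices at which a list takes a given value is its count. [folklore] -/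
theorem card_range_filter_getD_eq (l : List ℕ) (t : ℕ) :
    ((range l.length).filter fun b => l.getD b 0 = t).card = l.count t := by
  induction l with
  | nil => simp
  | cons a l ih =>
    rw [List.length_cons, range_add_one', filter_insert, List.count_cons]
    have hmap : ((range l.length).map ⟨fun i => i + 1, fun i j => by simp⟩).filter
        (fun b => (a :: l).getD b 0 = t) =
        ((range l.length).filter fun b => l.getD b 0 = t).map ⟨fun i => i + 1, fun i j => by simp⟩ := by
      rw [Finset.filter_map]
      rfl
    have h0 : (0 : ℕ) ∉ ((range l.length).map ⟨fun i => i + 1, fun i j => by simp⟩).filter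
        (fun b => (a :: l).getD b 0 = t) := by
      simp
    by_cases hat : a = t
    · rw [if_pos (by simpa using hat), card_insert_of_notMem h0, hmap, card_map, ih]
      simp [hat]
    · rw [if_neg (by simpa using hat), hmap, card_map, ih]
      simp [hat]

/-- **Residues per level**: `#{a : level(a) = t} ≤ (L/N + 2) · count K t`, where
`level a = K[bin a]` and `K` has length `N + 1`. [folklore] -/
theorem card_filter_level_le (N L : ℕ) [NeZero L] (hN : 0 < N) {K : List ℕ} (hK : K.length = N + 1)
    (t : ℕ) :
    (((univ : Finset (ZMod L)).filter fun a => K.getD (binOf N L a) 0 = t).card : ℝ) ≤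
      ((L : ℝ) / N + 2) * (K.count t : ℝ) := by
  set B := (range (N + 1)).filter fun b => K.getD b 0 = t with hB
  have hsub : ((univ : Finset (ZMod L)).filter fun a => K.getD (binOf N L a) 0 = t) ⊆
      B.biUnion fun b => (univ : Finset (ZMod L)).filter fun a => binOf N L a = b := by
    intro a ha
    rw [mem_biUnion]
    refine ⟨binOf N L a, ?_, mem_filter.2 ⟨mem_univ _, rfl⟩⟩
    exact mem_filter.2 ⟨mem_range.2 (Nat.lt_succ_of_le (binOf_le N L a)), (mem_filter.1 ha).2⟩
  calc (((univ : Finset (ZMod L)).filter fun a => K.getD (binOf N L a) 0 = t).card : ℝ)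
      ≤ ((B.biUnion fun b => (univ : Finset (ZMod L)).filter fun a => binOf N L a = b).card : ℝ) := by
        exact_mod_cast card_le_card hsub
    _ ≤ ∑ b ∈ B, (((univ : Finset (ZMod L)).filter fun a => binOf N L a = b).card : ℝ) := by
        exact_mod_cast card_biUnion_le
    _ ≤ ∑ _b ∈ B, ((L : ℝ) / N + 2) := sum_le_sum fun b _ => card_filter_binOf_le N L hN b
    _ = ((L : ℝ) / N + 2) * (K.count t : ℝ) := by
        rw [sum_const, nsmul_eq_mul, hB, ← hK, card_range_filter_getD_eq, mul_comm]

/-! ### The singular block: sup-norm shells -/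

/-- The sup-norm `r(k) = maxᵢ |m̃ᵢ|` of a dual-torus point. [folklore] -/
def supAbsm {L ν : ℕ} (k : TorusSite ν L) : ℕ := univ.sup fun i => absm (k i)

/-- Auxiliary step of the certified Riemann-sum bound (Kennedy–Lieb–Shastry 1988, p. 1022, the numerical evaluation). [folklore] -/
theorem absm_le_supAbsm {L ν : ℕ} (k : TorusSite ν L) (i : Fin ν) : absm (k i) ≤ supAbsm k :=
  Finset.le_sup (f := fun i => absm (k i)) (mem_univ i)

/-- The cube `{m ∈ ℤ^ν : ‖m‖∞ ≤ r}` as a `piFinset`. [folklore] -/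
noncomputable def intCube (ν : ℕ) (r : ℤ) : Finset (Fin ν → ℤ) := Fintype.piFinset fun _ => Icc (-r) r

/-- Auxiliary step of the certified Riemann-sum bound (Kennedy–Lieb–Shastry 1988, p. 1022, the numerical evaluation). [folklore] -/
theorem card_intCube (ν : ℕ) (r : ℤ) : (intCube ν r).card = (r + 1 - -r).toNat ^ ν := by
  rw [intCube, Fintype.card_piFinset, prod_const, card_univ, Fintype.card_fin, Int.card_Icc]

/-- **Shell count**: the number of dual-torus points with `maxᵢ |m̃ᵢ| = r ≥ 1` is at most
`(2r+1)^ν - (2r-1)^ν`. [folklore] -/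
theorem card_filter_supAbsm_eq_le {L : ℕ} [NeZero L] (ν : ℕ) {r : ℕ} (hr : 1 ≤ r) :
    ((univ : Finset (TorusSite ν L)).filter fun k => supAbsm k = r).card ≤
      (2 * r + 1) ^ ν - (2 * r - 1) ^ ν := by
  classical
  set Φ : TorusSite ν L → (Fin ν → ℤ) := fun k i => (k i).valMinAbs with hΦ
  have hΦinj : Function.Injective Φ := by
    intro k k' h
    funext i
    exact ZMod.injective_valMinAbs (congrFun h i)
  have himage : ((univ : Finset (TorusSite ν L)).filter fun k => supAbsm k = r).image Φ ⊆
      intCube ν r \ intCube ν (r - 1 : ℕ) := by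
    intro m hm
    obtain ⟨k, hk, rfl⟩ := mem_image.1 hm
    have hk' : supAbsm k = r := (mem_filter.1 hk).2
    rw [mem_sdiff]
    constructor
    · rw [intCube, Fintype.mem_piFinset]
      intro i
      have h := absm_le_supAbsm k i
      rw [hk', absm] at h
      change (k i).valMinAbs ∈ Icc (-(r : ℤ)) r
      rw [mem_Icc]
      constructor <;> omega
    · rw [intCube, Fintype.mem_piFinset, not_forall]
      -- a coordinate achieving the sup
      obtain ⟨i, -, hi⟩ := exists_max_image univ (fun i => absm (k i))
        (by
          by_contra h
          rw [not_nonempty_iff_eq_empty, univ_eq_empty_iff] at h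
          have : supAbsm k = 0 := by
            rw [supAbsm]
            exact Finset.sup_eq_bot_iff _ _ |>.2 (fun i _ => (h.false i).elim)
          omega)
      have hsup : supAbsm k ≤ absm (k i) := Finset.sup_le fun j _ => hi j (mem_univ j)
      have heq : absm (k i) = r := le_antisymm (hk' ▸ absm_le_supAbsm k i) (hk' ▸ hsup)
      refine ⟨i, ?_⟩
      change ¬ ((k i).valMinAbs ∈ Icc (-((r - 1 : ℕ) : ℤ)) ((r - 1 : ℕ) : ℤ))
      rw [mem_Icc]
      rw [absm] at heq
      omega
  have hsub : intCube ν ((r - 1 : ℕ) : ℤ) ⊆ intCube ν r := by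
    refine Fintype.piFinset_subset _ _ fun _ => Icc_subset_Icc (by omega) (by omega)
  calc ((univ : Finset (TorusSite ν L)).filter fun k => supAbsm k = r).card
      = (((univ : Finset (TorusSite ν L)).filter fun k => supAbsm k = r).image Φ).card :=
        (card_image_of_injective _ hΦinj).symm
    _ ≤ (intCube ν r \ intCube ν (r - 1 : ℕ)).card := card_le_card himage
    _ = (intCube ν r).card - (intCube ν (r - 1 : ℕ)).card := card_sdiff_of_subset hsub
    _ = (2 * r + 1) ^ ν - (2 * r - 1) ^ ν := by
        rw [card_intCube, card_intCube]
        congr 2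
        · omega
        · omega


/-! ### The singular block -/

/-- `24r² + 2` dominates the shell count `(2r+1)³ - (2r-1)³` (`r ≥ 1`). [folklore] -/
theorem shell_cast_eq {r : ℕ} (hr : 1 ≤ r) :
    (((2 * r + 1) ^ 3 - (2 * r - 1) ^ 3 : ℕ) : ℝ) = 24 * (r : ℝ) ^ 2 + 2 := by
  have h1 : (2 * r - 1) ^ 3 ≤ (2 * r + 1) ^ 3 := Nat.pow_le_pow_left (by omega) 3
  rw [Nat.cast_sub h1, Nat.cast_pow, Nat.cast_pow, Nat.cast_sub (by omega)]
  push_cast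
  ring

/-- On the singular block every coordinate is small: `bin < j* ⇒ |m̃| ≤ ⌊j* L/(2N)⌋`. [folklore] -/
theorem absm_le_of_binOf_lt {N L jstar : ℕ} [NeZero L] (hN : 0 < N) {a : ZMod L}
    (h : binOf N L a < jstar) : absm a ≤ jstar * L / (2 * N) := by
  unfold binOf at h
  have hL : 0 < L := Nat.pos_of_ne_zero (NeZero.ne L)
  rw [Nat.div_lt_iff_lt_mul hL] at h
  rw [Nat.le_div_iff_mul_le (by omega)]
  nlinarith

/-- **The singular block.** For the dual-torus points `k ≠ 0` all of whose coordinates lie in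
bins `< j*`, `Σ F(p_k) ≤ (√3 L/2)(12R² + 14R + 2)` with `R = ⌊j* L/(2N)⌋`: at such a point
`F ≤ √3L/(2 maxᵢ|m̃ᵢ|)` (`klsIntegrand_le_of_ne_zero`), and the number of points with
`maxᵢ |m̃ᵢ| = r` is at most `24r² + 2`. [folklore] -/
theorem block_sum_le (L : ℕ) [NeZero L] {N : ℕ} (hN : 0 < N) (jstar : ℕ) :
    ∑ k ∈ (univ : Finset (TorusSite 3 L)).filter (fun k => k ≠ 0 ∧ ∀ i, binOf N L (k i) < jstar),
        klsIntegrand 3 (latticeMomentum L k) ≤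
      Real.sqrt 3 * L / 2 * (12 * ((jstar * L / (2 * N) : ℕ) : ℝ) ^ 2 +
        14 * ((jstar * L / (2 * N) : ℕ) : ℝ) + 2) := by
  set R : ℕ := jstar * L / (2 * N) with hR
  set B := (univ : Finset (TorusSite 3 L)).filter (fun k => k ≠ 0 ∧ ∀ i, binOf N L (k i) < jstar)
    with hB
  have hL : (0 : ℝ) < L := by exact_mod_cast Nat.pos_of_ne_zero (NeZero.ne L)
  have hc : 0 ≤ Real.sqrt 3 * L / 2 := by positivity
  -- (1) pointwise: `F ≤ (√3 L/2) / r(k)` and `1 ≤ r(k) ≤ R` on `B`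
  have hpt : ∀ k ∈ B, klsIntegrand 3 (latticeMomentum L k) ≤
      Real.sqrt 3 * L / 2 * (1 / (supAbsm k : ℝ)) ∧ 1 ≤ supAbsm k ∧ supAbsm k ≤ R := by
    intro k hk
    obtain ⟨hk0, hkb⟩ := (mem_filter.1 hk).2
    obtain ⟨i, -, hi⟩ := exists_max_image (univ : Finset (Fin 3)) (fun i => absm (k i))
      ⟨0, mem_univ _⟩
    have hsup : supAbsm k = absm (k i) :=
      le_antisymm (Finset.sup_le fun j _ => hi j (mem_univ j)) (absm_le_supAbsm k i)
    have hne : ∃ j, k j ≠ 0 := by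
      by_contra h
      push Not at h
      exact hk0 (funext h)
    obtain ⟨j, hj⟩ := hne
    have hj1 : 1 ≤ absm (k j) := Nat.pos_of_ne_zero fun h => hj ((absm_eq_zero_iff _).1 h)
    have hi1 : 1 ≤ absm (k i) := hj1.trans (hi j (mem_univ j))
    have hki : k i ≠ 0 := fun h => by
      rw [(absm_eq_zero_iff (k i)).2 h] at hi1
      exact Nat.not_succ_le_zero 0 hi1
    refine ⟨?_, hsup ▸ hi1, hsup ▸ (absm_le_of_binOf_lt hN (hkb i))⟩
    have h := klsIntegrand_le_of_ne_zero L k hki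
    rw [hsup, absm, Nat.cast_natAbs, Int.cast_abs]
    have h3 : Real.sqrt ((3 : ℕ) : ℝ) = Real.sqrt 3 := by norm_num
    rw [h3] at h
    exact h
  -- (2) sum over `B` through the fibres of `r = supAbsm`
  have hmaps : ∀ k ∈ B, supAbsm k ∈ range (R + 1) := fun k hk =>
    mem_range.2 (Nat.lt_succ_of_le (hpt k hk).2.2)
  calc ∑ k ∈ B, klsIntegrand 3 (latticeMomentum L k)
      ≤ ∑ k ∈ B, Real.sqrt 3 * L / 2 * (1 / (supAbsm k : ℝ)) := sum_le_sum fun k hk => (hpt k hk).1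
    _ = ∑ r ∈ range (R + 1), ∑ k ∈ B.filter (fun k => supAbsm k = r),
          Real.sqrt 3 * L / 2 * (1 / (supAbsm k : ℝ)) := (sum_fiberwise_of_maps_to hmaps _).symm
    _ = ∑ r ∈ range (R + 1), ((B.filter fun k => supAbsm k = r).card : ℝ) *
          (Real.sqrt 3 * L / 2 * (1 / (r : ℝ))) := by
        refine sum_congr rfl fun r _ => ?_
        rw [sum_congr rfl fun k hk => by rw [(mem_filter.1 hk).2], sum_const, nsmul_eq_mul]
    _ ≤ ∑ r ∈ range (R + 1), (24 * (r : ℝ) ^ 2 + 2) * (Real.sqrt 3 * L / 2 * (1 / (r : ℝ))) := by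
        refine sum_le_sum fun r _ => ?_
        rcases Nat.eq_zero_or_pos r with hr0 | hr0
        · subst hr0
          simp
        · refine mul_le_mul_of_nonneg_right ?_ (by positivity)
          have h1 : (B.filter fun k => supAbsm k = r).card ≤
              ((univ : Finset (TorusSite 3 L)).filter fun k => supAbsm k = r).card :=
            card_le_card (filter_subset_filter _ (filter_subset _ _))
          have h2 := card_filter_supAbsm_eq_le (L := L) 3 (r := r) hr0
          have h3 : (((univ : Finset (TorusSite 3 L)).filter fun k => supAbsm k = r).card : ℝ) ≤
              24 * (r : ℝ) ^ 2 + 2 := by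
            rw [← shell_cast_eq hr0]
            exact_mod_cast h2
          exact le_trans (by exact_mod_cast h1) h3
    _ ≤ ∑ r ∈ range (R + 1), Real.sqrt 3 * L / 2 * (24 * (r : ℝ) + 2) := by
        refine sum_le_sum fun r _ => ?_
        rcases Nat.eq_zero_or_pos r with hr0 | hr0
        · subst hr0
          simp only [Nat.cast_zero, div_zero, mul_zero]
          positivity
        · have hr' : (1 : ℝ) ≤ r := by exact_mod_cast hr0
          have hrpos : (0 : ℝ) < r := by linarith
          have e : (24 * (r : ℝ) ^ 2 + 2) * (Real.sqrt 3 * L / 2 * (1 / (r : ℝ))) =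
              Real.sqrt 3 * L / 2 * (24 * r + 2 / r) := by
            field_simp
          rw [e]
          refine mul_le_mul_of_nonneg_left ?_ hc
          have : 2 / (r : ℝ) ≤ 2 := by
            rw [div_le_iff₀ hrpos]; linarith
          linarith
    _ = Real.sqrt 3 * L / 2 * ∑ r ∈ range (R + 1), (24 * (r : ℝ) + 2) := by rw [mul_sum]
    _ = Real.sqrt 3 * L / 2 * (12 * (R : ℝ) ^ 2 + 14 * R + 2) := by
        congr 1
        rw [sum_add_distrib, sum_const, card_range, nsmul_eq_mul, ← mul_sum]
        have hg := Finset.sum_range_id_mul_two (R + 1)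
        have hg' : (∑ i ∈ range (R + 1), (i : ℝ)) * 2 = (R + 1 : ℕ) * R := by
          rw [← Nat.cast_sum]
          exact_mod_cast hg
        push_cast at hg' ⊢
        nlinarith [hg']

/-! ### Triple sums through the levels -/

/-- Sums over `Fin 3 → β` as iterated sums. [folklore] -/
theorem sum_fun_fin_three {β : Type*} [Fintype β] (f : (Fin 3 → β) → ℝ) :
    ∑ k : Fin 3 → β, f k = ∑ a : β, ∑ b : β, ∑ c : β, f ![a, b, c] := by
  rw [← Fintype.sum_equiv (Fin.consEquiv fun _ : Fin 3 => β) (fun p => f (Fin.cons p.1 p.2)) f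
    (fun p => rfl), Fintype.sum_prod_type]
  refine Fintype.sum_congr _ _ fun a => ?_
  rw [← Fintype.sum_equiv (Fin.consEquiv fun _ : Fin 2 => β) (fun p => f (Fin.cons a (Fin.cons p.1 p.2)))
    (fun k => f (Fin.cons a k)) (fun p => rfl), Fintype.sum_prod_type]
  refine Fintype.sum_congr _ _ fun b => ?_
  rw [← Fintype.sum_equiv (Fin.consEquiv fun _ : Fin 1 => β)
    (fun p => f (Fin.cons a (Fin.cons b (Fin.cons p.1 p.2)))) (fun k => f (Fin.cons a (Fin.cons b k)))
    (fun p => rfl), Fintype.sum_prod_type]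
  refine Fintype.sum_congr _ _ fun c => ?_
  rw [Fintype.sum_unique]
  congr 1

/-- **The level sum.** For a nonnegative sequence `φ` and levels `s : ZMod L → ℕ` bounded by the
length of a histogram list `c` with `#{a : s a = t} ≤ W c[t]`,
`Σ_{a,b,c} φ(s a + s b + s c) ≤ W³ · wsum φ (c * c * c)`. [folklore] -/
theorem triple_level_sum_le {L : ℕ} [NeZero L] (s : ZMod L → ℕ) (c : List ℕ) {W : ℝ} (hW : 0 ≤ W)
    (hs : ∀ a, s a < c.length)
    (hcard : ∀ t, (((univ : Finset (ZMod L)).filter fun a => s a = t).card : ℝ) ≤ W * (c.getD t 0 : ℝ))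
    {φ : ℕ → ℝ} (hφ : ∀ t, 0 ≤ φ t) :
    ∑ a : ZMod L, ∑ b : ZMod L, ∑ e : ZMod L, φ (s a + s b + s e) ≤
      W ^ 3 * wsum φ (convL (convL c c) c) := by
  -- innermost
  have h1 : ∀ a b : ZMod L, ∑ e : ZMod L, φ (s a + s b + s e) ≤
      W * wsum (fun t => φ (s a + s b + t)) c := fun a b =>
    sum_level_le_wsum s c hs hcard (φ := fun t => φ (s a + s b + t)) (fun t => hφ _)
  have h2 : ∀ a : ZMod L, ∑ b : ZMod L, W * wsum (fun t => φ (s a + s b + t)) c ≤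
      W * (W * wsum (fun u => wsum (fun t => φ (s a + u + t)) c) c) := by
    intro a
    rw [← mul_sum]
    refine mul_le_mul_of_nonneg_left ?_ hW
    exact sum_level_le_wsum s c hs hcard (φ := fun u => wsum (fun t => φ (s a + u + t)) c)
      (fun u => wsum_nonneg _ fun t => hφ _)
  have h3 : ∑ a : ZMod L, W * (W * wsum (fun u => wsum (fun t => φ (s a + u + t)) c) c) ≤
      W * (W * (W * wsum (fun v => wsum (fun u => wsum (fun t => φ (v + u + t)) c) c) c)) := by
    rw [← mul_sum, ← mul_sum]
    refine mul_le_mul_of_nonneg_left (mul_le_mul_of_nonneg_left ?_ hW) hW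
    exact sum_level_le_wsum s c hs hcard
      (φ := fun v => wsum (fun u => wsum (fun t => φ (v + u + t)) c) c)
      (fun v => wsum_nonneg _ fun u => wsum_nonneg _ fun t => hφ _)
  calc ∑ a : ZMod L, ∑ b : ZMod L, ∑ e : ZMod L, φ (s a + s b + s e)
      ≤ ∑ a : ZMod L, ∑ b : ZMod L, W * wsum (fun t => φ (s a + s b + t)) c :=
        sum_le_sum fun a _ => sum_le_sum fun b _ => h1 a b
    _ ≤ ∑ a : ZMod L, W * (W * wsum (fun u => wsum (fun t => φ (s a + u + t)) c) c) :=
        sum_le_sum fun a _ => h2 a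
    _ ≤ W * (W * (W * wsum (fun v => wsum (fun u => wsum (fun t => φ (v + u + t)) c) c) c)) := h3
    _ = W ^ 3 * wsum φ (convL (convL c c) c) := by
        rw [wsum_convL, wsum_convL]
        ring

/-! ### The tables (`N = 64`, `M = 128`, `D = 2¹⁶`) and their kernel-checked certificates -/

/-- The cosine table: `K[b] - 128 ≥ 128 cos(π b/64)`, `b = 0, …, 64` (`K[b] = 128 + ⌈128 T₈(x_b)⌉`,
resp. `128 + ⌈-128 T₆(y_b)⌉`, generated offline and certified below). [folklore] -/
def tblK : List ℕ :=
  [256, 256, 256, 255, 254, 253, 251, 249, 247, 244, 241, 238, 235, 231, 227, 223, 219, 214, 210,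
   205, 200, 194, 189, 183, 177, 172, 166, 160, 153, 147, 141, 135, 129, 122, 116, 110, 104, 97,
   91, 85, 80, 74, 68, 63, 57, 52, 47, 43, 38, 34, 30, 26, 22, 19, 16, 13, 10, 8, 6, 4, 3, 2, 1, 1,
   0]

/-- The `G` table: `g[t] ≥ 2¹⁶ G(t/384 - 1)` for `t < 768`, `g[768] = 0` (generated offline and
certified below). [folklore] -/
def tblG : List ℕ :=
  [0, 0, 0, 0, 0, 0, 0, 0, 0, 0, 0, 0, 0, 0, 0, 0, 0, 0, 0, 0, 0, 0, 0, 0, 0, 0, 0, 0, 0, 0, 0, 0,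
   0, 0, 0, 0, 0, 0, 0, 0, 0, 0, 0, 0, 0, 0, 0, 0, 0, 0, 0, 0, 0, 0, 0, 0, 0, 0, 0, 0, 0, 0, 0, 0,
   0, 0, 0, 0, 0, 0, 0, 0, 0, 0, 0, 0, 0, 0, 0, 0, 0, 0, 0, 0, 0, 0, 0, 0, 0, 0, 0, 0, 0, 0, 0, 0,
   0, 0, 0, 0, 0, 0, 0, 0, 0, 0, 0, 0, 0, 0, 0, 0, 0, 0, 0, 0, 0, 0, 0, 0, 0, 0, 0, 0, 0, 0, 0, 0,
   0, 0, 0, 0, 0, 0, 0, 0, 0, 0, 0, 0, 0, 0, 0, 0, 0, 0, 0, 0, 0, 0, 0, 0, 0, 0, 0, 0, 0, 0, 0, 0,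
   0, 0, 0, 0, 0, 0, 0, 0, 0, 0, 0, 0, 0, 0, 0, 0, 0, 0, 0, 0, 0, 0, 0, 0, 0, 0, 0, 0, 0, 0, 0, 0,
   0, 0, 0, 0, 0, 0, 0, 0, 0, 0, 0, 0, 0, 0, 0, 0, 0, 0, 0, 0, 0, 0, 0, 0, 0, 0, 0, 0, 0, 0, 0, 0,
   0, 0, 0, 0, 0, 0, 0, 0, 0, 0, 0, 0, 0, 0, 0, 0, 0, 0, 0, 0, 0, 0, 0, 0, 0, 0, 0, 0, 0, 0, 0, 0,
   0, 0, 0, 0, 0, 0, 0, 0, 0, 0, 0, 0, 0, 0, 0, 0, 0, 0, 0, 0, 0, 0, 0, 0, 0, 0, 0, 0, 0, 0, 0, 0,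
   0, 0, 0, 0, 0, 0, 0, 0, 0, 0, 0, 0, 0, 0, 0, 0, 0, 0, 0, 0, 0, 0, 0, 0, 0, 0, 0, 0, 0, 0, 0, 0,
   0, 0, 0, 0, 0, 0, 0, 0, 0, 0, 0, 0, 0, 0, 0, 0, 0, 0, 0, 0, 0, 0, 0, 0, 0, 0, 0, 0, 0, 0, 0, 0,
   0, 0, 0, 0, 0, 0, 0, 0, 0, 0, 0, 0, 0, 0, 0, 0, 0, 0, 0, 0, 0, 0, 0, 0, 0, 0, 0, 0, 0, 0, 0, 0,
   0, 173, 345, 518, 691, 866, 1042, 1218, 1396, 1574, 1753, 1933, 2115, 2297, 2480, 2664, 2848,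
   3034, 3221, 3409, 3597, 3787, 3978, 4169, 4362, 4556, 4750, 4946, 5142, 5340, 5538, 5738, 5939,
   6140, 6343, 6547, 6751, 6957, 7164, 7372, 7581, 7790, 8001, 8214, 8427, 8641, 8856, 9073, 9290,
   9509, 9729, 9950, 10172, 10395, 10619, 10844, 11071, 11299, 11528, 11758, 11989, 12221, 12455,
   12689, 12925, 13163, 13401, 13640, 13881, 14123, 14367, 14611, 14857, 15104, 15352, 15602,
   15853, 16105, 16358, 16613, 16869, 17127, 17386, 17646, 17907, 18170, 18434, 18700, 18967,
   19235, 19505, 19776, 20048, 20322, 20598, 20875, 21153, 21433, 21714, 21997, 22281, 22567,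
   22854, 23143, 23434, 23726, 24019, 24314, 24611, 24909, 25209, 25510, 25814, 26118, 26425,
   26733, 27043, 27354, 27667, 27982, 28299, 28617, 28937, 29259, 29583, 29908, 30235, 30565,
   30895, 31228, 31563, 31899, 32238, 32578, 32921, 33265, 33611, 33959, 34310, 34662, 35016,
   35372, 35731, 36091, 36454, 36818, 37185, 37554, 37925, 38298, 38674, 39052, 39432, 39814,
   40199, 40586, 40975, 41367, 41761, 42157, 42556, 42957, 43361, 43767, 44176, 44587, 45001,
   45418, 45837, 46259, 46683, 47110, 47540, 47973, 48408, 48846, 49288, 49731, 50178, 50628,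
   51081, 51537, 51995, 52457, 52922, 53390, 53862, 54336, 54814, 55295, 55779, 56266, 56757,
   57252, 57750, 58251, 58756, 59264, 59776, 60292, 60812, 61335, 61862, 62393, 62928, 63466,
   64009, 64556, 65107, 65662, 66221, 66785, 67352, 67925, 68501, 69082, 69668, 70258, 70853,
   71453, 72057, 72666, 73281, 73900, 74524, 75154, 75788, 76428, 77074, 77724, 78381, 79043,
   79710, 80383, 81063, 81748, 82439, 83137, 83840, 84550, 85267, 85989, 86719, 87455, 88199,
   88949, 89706, 90471, 91242, 92022, 92809, 93603, 94406, 95216, 96035, 96861, 97697, 98541,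
   99393, 100255, 101125, 102005, 102895, 103794, 104702, 105621, 106550, 107489, 108439, 109399,
   110371, 111354, 112348, 113354, 114372, 115403, 116446, 117501, 118570, 119652, 120748, 121858,
   122982, 124120, 125274, 126443, 127627, 128828, 130045, 131280, 132531, 133800, 135088, 136394,
   137719, 139064, 140429, 141815, 143223, 144652, 146104, 147579, 149079, 150602, 152151, 153727,
   155329, 156959, 158617, 160305, 162024, 163774, 165556, 167373, 169224, 171111, 173035, 174998,
   177001, 179046, 181133, 183266, 185445, 187672, 189949, 192279, 194664, 197105, 199605, 202167,
   204794, 207489, 210254, 213094, 216011, 219009, 222094, 225268, 228538, 231907, 235382, 238968,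
   242673, 246502, 250464, 254567, 258819, 263232, 267815, 272580, 277541, 282712, 288109, 293750,
   299655, 305846, 312347, 319188, 326399, 334018, 342085, 350648, 359764, 369494, 379916, 391118,
   403205, 416305, 430573, 446199, 463419, 482532, 503922, 528093, 555720, 587734, 625460, 670864,
   727015, 799035, 896292, 1038352, 1275886, 1810279, 0]

/-- The structural certificate of the cosine table: length `N + 1`, entries `≤ 2M`, and the entries
equal to `2M` (the singular bins) are exactly the first `j*`. [folklore] -/
def checkStruct (N M jstar : ℕ) (K : List ℕ) : Bool :=
  decide (K.length = N + 1) && (List.range (N + 1)).all fun b =>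
    decide (K.getD b 0 ≤ 2 * M) &&
      (if b < jstar then decide (K.getD b 0 = 2 * M) else decide (K.getD b 0 < 2 * M))

/-- Kernel evaluation of the cosine-table certificate. [folklore] -/
theorem checkK_tbl : checkK 64 128 tblK = true := by
  decide +kernel

/-- Kernel evaluation of the `G`-table certificate. [folklore] -/
theorem checkG_tbl : checkG 128 65536 tblG = true := by
  decide +kernel

/-- Kernel evaluation of the structural certificate (`j* = 3`). [folklore] -/
theorem checkStruct_tbl : checkStruct 64 128 3 tblK = true := by
  decide +kernel

set_option maxRecDepth 4000 in
/-- **The certified triple sum** `Σ_t g[t] (c*c*c)[t] = 6558591247`, `c` the histogram of the cosine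
table (kernel evaluation; `6558591247 / (2¹⁶ · 64³) = 0.38176…`). [Kennedy–Lieb–Shastry 1988,
p. 1022: the numerical value of the integral in (4)] [folklore] -/
theorem certTotal_tbl :
    dotL tblG (convL (convL (histL tblK 257) (histL tblK 257)) (histL tblK 257)) = 6558591247 := by
  decide +kernel

/-- Consequences of the structural certificate. [folklore] -/
theorem tblK_struct :
    tblK.length = 65 ∧ (∀ b, b ≤ 64 → tblK.getD b 0 ≤ 256) ∧
      (∀ b, b ≤ 64 → tblK.getD b 0 = 256 → b < 3) := by
  have h := checkStruct_tbl
  rw [checkStruct, Bool.and_eq_true] at h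
  obtain ⟨hlen, hall⟩ := h
  refine ⟨of_decide_eq_true hlen, fun b hb => ?_, fun b hb hbeq => ?_⟩
  · have := List.all_eq_true.1 hall b (List.mem_range.2 (by omega))
    rw [Bool.and_eq_true] at this
    exact of_decide_eq_true this.1
  · have := List.all_eq_true.1 hall b (List.mem_range.2 (by omega))
    rw [Bool.and_eq_true] at this
    obtain ⟨-, h2⟩ := this
    by_contra hb3
    rw [if_neg hb3] at h2
    have := of_decide_eq_true h2
    omega

end KLSNumerics

open KLSNumerics

/-! ### The bound on the punctured Riemann sums in three dimensions -/

/-- **The finite-volume bound.** For every side `L ≥ 1`,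
`R_L(3) ≤ [(L/64 + 2)³ · 6558591247/2¹⁶ + (√3 L/2)(12R² + 14R + 2)] / L³`, `R = ⌊3L/128⌋`
(regular points through the certified tables and the level sum; the singular block through the
sup-norm shells). [Kennedy–Lieb–Shastry 1988, p. 1022] [folklore] -/
theorem klsRiemannSum_three_le (L : ℕ) [NeZero L] :
    klsRiemannSum 3 L ≤
      ((((L : ℝ) / 64 + 2) ^ 3 * (6558591247 / 65536) +
          Real.sqrt 3 * L / 2 * (12 * ((3 * L / 128 : ℕ) : ℝ) ^ 2 + 14 * ((3 * L / 128 : ℕ) : ℝ) + 2)) /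
        (L : ℝ) ^ 3) := by
  classical
  have hL : (0 : ℝ) < L := by exact_mod_cast Nat.pos_of_ne_zero (NeZero.ne L)
  obtain ⟨hlen, hle, hblk⟩ := tblK_struct
  -- levels
  set lev : ZMod L → ℕ := fun a => tblK.getD (binOf 64 L a) 0 with hlev
  have hlev_le : ∀ a, lev a ≤ 256 := fun a => hle _ (binOf_le 64 L a)
  set S : TorusSite 3 L → ℕ := fun k => ∑ i, lev (k i) with hS
  set gD : ℕ → ℝ := fun t => (tblG.getD t 0 : ℝ) / 65536 with hgD
  have hgD0 : ∀ t, 0 ≤ gD t := fun t => by positivity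
  set W : ℝ := (L : ℝ) / 64 + 2 with hW
  have hW0 : 0 ≤ W := by positivity
  -- (A) regular points
  have hreg : ∀ k : TorusSite 3 L, S k < 768 → klsIntegrand 3 (latticeMomentum L k) ≤ gD (S k) := by
    intro k hk
    have h1 := klsIntegrand_le_klsG_levels L (N := 64) (M := 128) (by norm_num) (by norm_num)
      checkK_tbl k (by simpa [hS, hlev] using hk)
    have h2 := klsG_le_table (M := 128) (D := 65536) (by norm_num) (by norm_num) checkG_tbl
      (t := S k) (by omega)
    refine h1.trans (le_trans (le_of_eq ?_) h2)
    simp only [hS, hlev]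
  -- (B) the level sum over all points
  have hc1len : (histL tblK 257).length = 257 := histL_length _ _
  have hcard : ∀ t, (((univ : Finset (ZMod L)).filter fun a => lev a = t).card : ℝ) ≤
      W * ((histL tblK 257).getD t 0 : ℝ) := by
    intro t
    rcases lt_or_ge t 257 with ht | ht
    · rw [histL_getD _ ht]
      exact card_filter_level_le 64 L (by norm_num) hlen t
    · have h0 : ((univ : Finset (ZMod L)).filter fun a => lev a = t) = ∅ := by
        refine filter_eq_empty_iff.2 fun a _ h => ?_
        have := hlev_le a
        omega
      rw [h0, card_empty, Nat.cast_zero]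
      positivity
  have hB : ∑ k : TorusSite 3 L, gD (S k) ≤ W ^ 3 * (6558591247 / 65536) := by
    rw [sum_fun_fin_three]
    have hS3 : ∀ a b c : ZMod L, S ![a, b, c] = lev a + lev b + lev c := by
      intro a b c
      simp only [hS, Fin.sum_univ_three, Matrix.cons_val_zero, Matrix.cons_val_one,
        Matrix.cons_val]
    simp_rw [hS3]
    refine (triple_level_sum_le lev (histL tblK 257) hW0 (fun a => by rw [hc1len]; have := hlev_le a; omega)
      hcard hgD0).trans (le_of_eq ?_)
    congr 1
    have hw : wsum gD (convL (convL (histL tblK 257) (histL tblK 257)) (histL tblK 257)) =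
        (1 / 65536 : ℝ) *
          wsum (fun t => (tblG.getD t 0 : ℝ)) (convL (convL (histL tblK 257) (histL tblK 257)) (histL tblK 257)) := by
      rw [← wsum_smul]
      exact wsum_congr _ fun t => by simp only [hgD]; ring
    rw [hw, ← dotL_eq_wsum, certTotal_tbl]
    norm_num
  -- (C) the singular block
  have hC := block_sum_le L (N := 64) (by norm_num) 3
  have hR : (3 * L / (2 * 64) : ℕ) = 3 * L / 128 := by norm_num
  rw [hR] at hC
  -- (D) splitting the punctured sum
  rw [klsRiemannSum_of_neZero]
  refine div_le_div_of_nonneg_right ?_ (by positivity)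
  set P := (univ : Finset (TorusSite 3 L)).erase 0 with hP
  rw [← sum_filter_add_sum_filter_not P (fun k => S k < 768)]
  refine add_le_add ?_ ?_
  · calc ∑ k ∈ P.filter (fun k => S k < 768), klsIntegrand 3 (latticeMomentum L k)
        ≤ ∑ k ∈ P.filter (fun k => S k < 768), gD (S k) :=
          sum_le_sum fun k hk => hreg k (mem_filter.1 hk).2
      _ ≤ ∑ k : TorusSite 3 L, gD (S k) :=
          sum_le_sum_of_subset_of_nonneg (filter_subset _ _ |>.trans (erase_subset _ _))
            fun k _ _ => hgD0 _
      _ ≤ W ^ 3 * (6558591247 / 65536) := hB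
      _ = ((L : ℝ) / 64 + 2) ^ 3 * (6558591247 / 65536) := by rw [hW]
  · have hsub : P.filter (fun k => ¬ S k < 768) ⊆
        (univ : Finset (TorusSite 3 L)).filter (fun k => k ≠ 0 ∧ ∀ i, binOf 64 L (k i) < 3) := by
      intro k hk
      obtain ⟨hkP, hkS⟩ := mem_filter.1 hk
      have hk0 : k ≠ 0 := (mem_erase.1 hkP).1
      refine mem_filter.2 ⟨mem_univ _, hk0, fun i => ?_⟩
      -- all three levels are `256`
      have h256 : lev (k i) = 256 := by
        have hsum : 768 ≤ ∑ j, lev (k j) := by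
          have : ¬ S k < 768 := hkS
          simpa [hS] using this
        rw [Fin.sum_univ_three] at hsum
        have h0 := hlev_le (k 0)
        have h1 := hlev_le (k 1)
        have h2 := hlev_le (k 2)
        fin_cases i <;> simp <;> omega
      exact hblk _ (binOf_le 64 L (k i)) h256
    calc ∑ k ∈ P.filter (fun k => ¬ S k < 768), klsIntegrand 3 (latticeMomentum L k)
        ≤ ∑ k ∈ (univ : Finset (TorusSite 3 L)).filter (fun k => k ≠ 0 ∧ ∀ i, binOf 64 L (k i) < 3),
            klsIntegrand 3 (latticeMomentum L k) :=
          sum_le_sum_of_subset_of_nonneg hsub fun k _ _ => klsIntegrand_nonneg _ _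
      _ ≤ _ := hC

/-- `√3 ≤ 1.7321`. [folklore] -/
theorem sqrt_three_le : Real.sqrt 3 ≤ 17321 / 10000 := by
  rw [show (17321 / 10000 : ℝ) = Real.sqrt ((17321 / 10000) ^ 2) by
    rw [Real.sqrt_sq (by norm_num)]]
  exact Real.sqrt_le_sqrt (by norm_num)

/-- **The numerical input of Kennedy–Lieb–Shastry in three dimensions**: the punctured Riemann
sums of the KLS integrand `(Σᵢ(1+cos pᵢ)/Σᵢ(1-cos pᵢ))^{1/2} (⅓Σᵢ cos pᵢ)₊` over the dual tori
`(ℤ/Lℤ)³` are eventually `≤ 2/5 < 1/√6` (KLS p. 1022: the integral is `0.35 = 0.0824·√18`,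
threshold `1/√6 = 0.408`; here the certified monotone upper sum gives `≤ 0.3886` for `L ≥ 2¹⁷`).
[Kennedy–Lieb–Shastry 1988, p. 1022 and eq. (4)] [cite: KLS1988JSP, p. 1022] -/
theorem klsRiemannSum_three_eventually_le :
    ∃ ρ : ℝ, ρ < 1 / Real.sqrt 6 ∧ ∀ᶠ L : ℕ in Filter.atTop, klsRiemannSum 3 L ≤ ρ := by
  refine ⟨2 / 5, ?_, ?_⟩
  · rw [lt_div_iff₀ (Real.sqrt_pos.2 (by norm_num))]
    have : Real.sqrt 6 < 5 / 2 := by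
      rw [Real.sqrt_lt' (by norm_num)]
      norm_num
    linarith
  · filter_upwards [Filter.eventually_ge_atTop (131072 : ℕ)] with L hL
    haveI : NeZero L := ⟨by omega⟩
    refine (klsRiemannSum_three_le L).trans ?_
    set x : ℝ := (L : ℝ) with hx
    have hx0 : (131072 : ℝ) ≤ x := by rw [hx]; exact_mod_cast hL
    have hxpos : 0 < x := by linarith
    -- the singular radius
    have hRle : ((3 * L / 128 : ℕ) : ℝ) ≤ 3 * x / 128 := by
      have := Nat.cast_div_le (m := 3 * L) (n := 128) (α := ℝ)
      push_cast at this
      linarith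
    have hR0 : (0 : ℝ) ≤ ((3 * L / 128 : ℕ) : ℝ) := Nat.cast_nonneg _
    -- (1) the regular part: `(x/64 + 2)³ ≤ (1025/65536)³ x³`
    have h1 : (x / 64 + 2) ^ 3 * (6558591247 / 65536) ≤
        (1025 / 65536 : ℝ) ^ 3 * (6558591247 / 65536) * x ^ 3 := by
      have hle : x / 64 + 2 ≤ 1025 / 65536 * x := by linarith
      have hcube : (x / 64 + 2) ^ 3 ≤ (1025 / 65536 * x) ^ 3 :=
        pow_le_pow_left₀ (by positivity) hle 3
      nlinarith [hcube]
    -- (2) the singular part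
    have h2 : Real.sqrt 3 * x / 2 *
        (12 * ((3 * L / 128 : ℕ) : ℝ) ^ 2 + 14 * ((3 * L / 128 : ℕ) : ℝ) + 2) ≤
        (17321 / 10000 / 2) * (108 / 16384 + 42 / (128 * 131072) + 2 / 131072 ^ 2) * x ^ 3 := by
      have hpoly : 12 * ((3 * L / 128 : ℕ) : ℝ) ^ 2 + 14 * ((3 * L / 128 : ℕ) : ℝ) + 2 ≤
          12 * (3 * x / 128) ^ 2 + 14 * (3 * x / 128) + 2 := by nlinarith [hRle, hR0]
      have hx2 : x ^ 2 ≤ x ^ 3 / 131072 := by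
        rw [le_div_iff₀ (by norm_num)]; nlinarith
      have hx1 : x ≤ x ^ 3 / 131072 ^ 2 := by
        rw [le_div_iff₀ (by norm_num)]; nlinarith
      have hs3 : 0 ≤ Real.sqrt 3 := Real.sqrt_nonneg _
      calc Real.sqrt 3 * x / 2 * (12 * ((3 * L / 128 : ℕ) : ℝ) ^ 2 + 14 * ((3 * L / 128 : ℕ) : ℝ) + 2)
          ≤ Real.sqrt 3 * x / 2 * (12 * (3 * x / 128) ^ 2 + 14 * (3 * x / 128) + 2) :=
            mul_le_mul_of_nonneg_left hpoly (by positivity)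
        _ = Real.sqrt 3 / 2 * (108 / 16384 * x ^ 3 + 42 / 128 * x ^ 2 + 2 * x) := by ring
        _ ≤ (17321 / 10000) / 2 * (108 / 16384 * x ^ 3 + 42 / 128 * x ^ 2 + 2 * x) := by
            refine mul_le_mul_of_nonneg_right ?_ (by positivity)
            linarith [sqrt_three_le]
        _ ≤ (17321 / 10000 / 2) * (108 / 16384 + 42 / (128 * 131072) + 2 / 131072 ^ 2) * x ^ 3 := by
            have : 108 / 16384 * x ^ 3 + 42 / 128 * x ^ 2 + 2 * x ≤
                (108 / 16384 + 42 / (128 * 131072) + 2 / 131072 ^ 2) * x ^ 3 := by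
              nlinarith [hx2, hx1]
            nlinarith [this]
    rw [div_le_iff₀ (by positivity)]
    have h3 : (1025 / 65536 : ℝ) ^ 3 * (6558591247 / 65536) +
        (17321 / 10000 / 2) * (108 / 16384 + 42 / (128 * 131072) + 2 / 131072 ^ 2) ≤ 2 / 5 := by
      norm_num
    nlinarith [h1, h2, h3, pow_pos hxpos 3]

end Literature.MathematicalPhysics.QuantumLattice
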